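import Summits.PneNP.PneNP.Theorems.ConvexRankGatesConvexGateBlindExactLiftingRankCorner

/-!
# Rigidity rung 0 for `ExactLifting`: the junta NMF of the single-equation Index-lift is UNIQUE

Support file for crux `ConvexGateBlind` (stmt-PneNP-10680), line `xor-door-perfect-completeness`, open stub
`stub_exactLifting` (lead c3; memo `ExactLifting-c3.md` §3: the LP half of the stub is a RIGIDITY statement about all
exact non-negative factorisations of the unshifted lift). Base case, exact and error-free: for ONE genuine equation
`y_i + y_j + y_l = b` and the `t³` pointers through the triple, the 0/1 matrix `A[x,π] = 1[x_i(π₁)+x_j(π₂)+x_l(π₃) ≠ b]`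
(rows: all string tables) has exactly ONE non-negative factorisation with `t³` terms up to permutation and positive
scaling — the junta one (`junta_nmf_unique`, registered def-free form `junta_nmf_unique_explicit`). Core step
`sliceW_eq_zero` (one bit flip in block `i` on four planted tables: coefficient pattern `±4·δ_{π'}`); the columns of
`A` are linearly independent (rank-corner file), so `V` is invertible, `U = A V⁻¹`, and positivity pins each column
of `V⁻¹` to one pointer. Elementary; no citation needed.
-/

set_option linter.dupNamespace false -- `Summit.PneNP.PneNP.…`: summit = sub-problem (D-0017)

namespace Summit.PneNP.PneNP.Theorems.XorDoor.RankCorner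

open scoped BigOperators Classical
open Finset Matrix

noncomputable section

variable {m t : ℕ}

/-! ## §1 The single-equation lift through the triple -/

/-- Entry of the single-equation lift at a table `x` and a pointer triple `π`:
`1[x_i(π₁) + x_j(π₂) + x_l(π₃) ≠ b]`. -/
def Aent (i j l : Fin m) (b : ZMod 2) (x : Fin m → Fin t → ZMod 2) (π : Fin t × Fin t × Fin t) : ℝ :=
  if x i π.1 + x j π.2.1 + x l π.2.2 = b then 0 else 1

/-- `Aent` is the column of the (unshifted) lift of the one-equation system through `ptrOf`. -/
theorem col_singleton_ptrOf {i j l : Fin m} (hij : i ≠ j) (hil : i ≠ l) (hjl : j ≠ l) (b : ZMod 2)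
    (π : Fin t × Fin t × Fin t) (x : Fin m → Fin t → ZMod 2) :
    col ({(i, j, l, b)} : Finset (Pool m)) 0 (ptrOf i j l π) x = Aent i j l b x π := by
  rw [col_eq_sum, Finset.sum_singleton, sub_zero]
  unfold vInd Aent
  simp only [ptrOf_i, ptrOf_j hij, ptrOf_l hil hjl]

/-- The columns `π ↦ Aent i j l b · π` are linearly independent. -/
theorem linearIndependent_Aent {i j l : Fin m} (hij : i ≠ j) (hil : i ≠ l) (hjl : j ≠ l) (b : ZMod 2) :
    LinearIndependent ℝ (fun (π : Fin t × Fin t × Fin t) (x : Fin m → Fin t → ZMod 2) => Aent i j l b x π) := by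
  have h := linearIndependent_col (t := t) (F := ({(i, j, l, b)} : Finset (Pool m))) hij hil hjl
    ⟨(i, j, l, b), Finset.mem_singleton_self _, rfl⟩
    (fun e he e' he' _ _ => by
      rw [Finset.mem_singleton] at he he'
      rw [he, he']) 0
  have hfun : (fun (π : Fin t × Fin t × Fin t) => col ({(i, j, l, b)} : Finset (Pool m)) 0 (ptrOf i j l π)) =
      fun (π : Fin t × Fin t × Fin t) (x : Fin m → Fin t → ZMod 2) => Aent i j l b x π := by
    funext π x
    exact col_singleton_ptrOf hij hil hjl b π x
  rw [hfun] at h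
  exact h

/-! ## §2 The combinatorial core: four planted tables and one bit flip -/

/-- The planted table `X p q`: block `i` carries `c` at position `π₀.1` (chosen so that the table is satisfied at
`π₀`), block `j` carries `p` at `β`, block `l` carries `q` at `γ`, everything else is `0`. -/
def Xtab (i j l : Fin m) (k₀ β γ : Fin t) (c p q : ZMod 2) : Fin m → Fin t → ZMod 2 :=
  fun a k => if a = i ∧ k = k₀ then c else if a = j ∧ k = β then p else if a = l ∧ k = γ then q else 0

/-- Block `i` of the planted table. -/
theorem Xtab_i {i j l : Fin m} (hij : i ≠ j) (hil : i ≠ l) (k₀ β γ : Fin t) (c p q : ZMod 2) (k : Fin t) :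
    Xtab i j l k₀ β γ c p q i k = if k = k₀ then c else 0 := by
  unfold Xtab; by_cases hk : k = k₀ <;> simp [hk, hij, hil]

/-- Block `j` of the planted table. -/
theorem Xtab_j {i j l : Fin m} (hij : i ≠ j) (hjl : j ≠ l) (k₀ β γ : Fin t) (c p q : ZMod 2) (k : Fin t) :
    Xtab i j l k₀ β γ c p q j k = if k = β then p else 0 := by
  unfold Xtab; by_cases hk : k = β <;> simp [hk, hij.symm, hjl]

/-- Block `l` of the planted table. -/
theorem Xtab_l {i j l : Fin m} (hil : i ≠ l) (hjl : j ≠ l) (k₀ β γ : Fin t) (c p q : ZMod 2) (k : Fin t) :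
    Xtab i j l k₀ β γ c p q l k = if k = γ then q else 0 := by
  unfold Xtab; by_cases hk : k = γ <;> simp [hk, hil.symm, hjl.symm]

/-- **Slice vanishing.** If `Σ_π A[x,π]·W(π) = 0` for every table `x` satisfied at `π₀`, then `W(π') = 0` for every
`π'` with `π'.1 ≠ π₀.1`. -/
theorem sliceW_eq_zero {i j l : Fin m} (hij : i ≠ j) (hil : i ≠ l) (hjl : j ≠ l) (b : ZMod 2)
    (W : Fin t × Fin t × Fin t → ℝ) (π₀ : Fin t × Fin t × Fin t)
    (hW : ∀ x : Fin m → Fin t → ZMod 2, x i π₀.1 + x j π₀.2.1 + x l π₀.2.2 = b →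
      ∑ π, Aent i j l b x π * W π = 0)
    (π' : Fin t × Fin t × Fin t) (hπ' : π'.1 ≠ π₀.1) : W π' = 0 := by
  -- names
  set κ := π'.1 with hκ
  set β := π'.2.1 with hβ
  set γ := π'.2.2 with hγ
  -- the constant making the planted tables satisfied at `π₀`
  let c : ZMod 2 → ZMod 2 → ZMod 2 := fun p q =>
    b - (if π₀.2.1 = β then p else 0) - (if π₀.2.2 = γ then q else 0)
  let X : ZMod 2 → ZMod 2 → (Fin m → Fin t → ZMod 2) := fun p q => Xtab i j l π₀.1 β γ (c p q) p q
  -- reads of the planted table and of its flip at `(i, κ)`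
  have hXi : ∀ p q k, X p q i k = if k = π₀.1 then c p q else 0 := fun p q k => Xtab_i hij hil _ _ _ _ _ _ k
  have hXj : ∀ p q k, X p q j k = if k = β then p else 0 := fun p q k => Xtab_j hij hjl _ _ _ _ _ _ k
  have hXl : ∀ p q k, X p q l k = if k = γ then q else 0 := fun p q k => Xtab_l hil hjl _ _ _ _ _ _ k
  have hFi : ∀ p q k, flipAt i κ (X p q) i k = (if k = π₀.1 then c p q else 0) + if k = κ then 1 else 0 := by
    intro p q k
    unfold flipAt
    rw [hXi]
    by_cases hk : k = κ <;> simp [hk]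
  have hFj : ∀ p q k, flipAt i κ (X p q) j k = if k = β then p else 0 := by
    intro p q k
    unfold flipAt
    rw [if_neg (fun h => hij h.1.symm), hXj]
  have hFl : ∀ p q k, flipAt i κ (X p q) l k = if k = γ then q else 0 := by
    intro p q k
    unfold flipAt
    rw [if_neg (fun h => hil h.1.symm), hXl]
  -- both the planted table and its flip are satisfied at `π₀`
  have hsat : ∀ p q, X p q i π₀.1 + X p q j π₀.2.1 + X p q l π₀.2.2 = b := by
    intro p q
    rw [hXi, hXj, hXl, if_pos rfl]
    simp only [c]
    ring
  have hsat' : ∀ p q, flipAt i κ (X p q) i π₀.1 + flipAt i κ (X p q) j π₀.2.1 +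
      flipAt i κ (X p q) l π₀.2.2 = b := by
    intro p q
    rw [hFi, hFj, hFl, if_pos rfl, if_neg (Ne.symm hπ'), add_zero]
    simp only [c]
    ring
  -- the difference of the two relations, entrywise (a finite check over `𝔽₂`)
  have key3 : ∀ a c' b' : ZMod 2, ((if 1 + a + c' = b' then (0 : ℝ) else 1) -
      (if a + c' = b' then (0 : ℝ) else 1)) = (if a + c' = b' then (1 : ℝ) else -1) := by
    intro a c' b'
    have h11 : (1 : ZMod 2) + 1 = 0 := by decide
    rcases zmod2_cases a with ha | ha <;> rcases zmod2_cases c' with hc | hc <;>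
      rcases zmod2_cases b' with hb | hb <;> simp [ha, hc, hb, h11]
  have hdiff : ∀ p q π, Aent i j l b (flipAt i κ (X p q)) π - Aent i j l b (X p q) π =
      if π.1 = κ then
        (if (if π.2.1 = β then p else 0) + (if π.2.2 = γ then q else 0) = b then (1 : ℝ) else -1)
      else 0 := by
    intro p q π
    unfold Aent
    rw [hFi, hFj, hFl, hXi, hXj, hXl]
    by_cases h1 : π.1 = κ
    · rw [if_pos h1]
      have hk : ¬ (π.1 = π₀.1) := fun h => hπ' (h1.symm.trans h)
      rw [if_neg hk, if_pos h1]
      simp only [zero_add]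
      exact key3 _ _ _
    · rw [if_neg h1, if_neg h1, add_zero, sub_self]
  -- the eight relations
  have hA : ∀ p q, ∑ π, Aent i j l b (X p q) π * W π = 0 := fun p q => hW _ (hsat p q)
  have hA' : ∀ p q, ∑ π, Aent i j l b (flipAt i κ (X p q)) π * W π = 0 := fun p q => hW _ (hsat' p q)
  -- the signed combination has coefficient `±4` at `π'` and `0` elsewhere
  have hππ' : ∀ π : Fin t × Fin t × Fin t, π = π' ↔ (π.1 = κ ∧ π.2.1 = β ∧ π.2.2 = γ) := fun π =>
    ⟨by rintro rfl; exact ⟨rfl, rfl, rfl⟩, fun h => Prod.ext h.1 (Prod.ext h.2.1 h.2.2)⟩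
  have hcoef : ∀ π : Fin t × Fin t × Fin t,
      (Aent i j l b (flipAt i κ (X 0 0)) π - Aent i j l b (X 0 0) π)
        - (Aent i j l b (flipAt i κ (X 1 0)) π - Aent i j l b (X 1 0) π)
        - (Aent i j l b (flipAt i κ (X 0 1)) π - Aent i j l b (X 0 1) π)
        + (Aent i j l b (flipAt i κ (X 1 1)) π - Aent i j l b (X 1 1) π) =
      if π = π' then (if b = 0 then (4 : ℝ) else -4) else 0 := by
    intro π
    rw [hdiff, hdiff, hdiff, hdiff]
    have h11 : (1 : ZMod 2) + 1 = 0 := by decide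
    by_cases h1 : π.1 = κ
    · by_cases h2 : π.2.1 = β
      · by_cases h3 : π.2.2 = γ
        · rw [if_pos ((hππ' π).2 ⟨h1, h2, h3⟩)]
          rcases zmod2_cases b with hb | hb <;> simp [h1, h2, h3, hb, h11] <;> norm_num
        · rw [if_neg (fun h => h3 ((hππ' π).1 h).2.2)]
          rcases zmod2_cases b with hb | hb <;> simp [h1, h2, h3, hb]
      · rw [if_neg (fun h => h2 ((hππ' π).1 h).2.1)]
        by_cases h3 : π.2.2 = γ <;>
          rcases zmod2_cases b with hb | hb <;> simp [h1, h2, h3, hb]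
    · rw [if_neg h1, if_neg h1, if_neg h1, if_neg h1, if_neg (fun h => h1 ((hππ' π).1 h).1)]
      norm_num
  have hsum : ∑ π, ((Aent i j l b (flipAt i κ (X 0 0)) π - Aent i j l b (X 0 0) π)
        - (Aent i j l b (flipAt i κ (X 1 0)) π - Aent i j l b (X 1 0) π)
        - (Aent i j l b (flipAt i κ (X 0 1)) π - Aent i j l b (X 0 1) π)
        + (Aent i j l b (flipAt i κ (X 1 1)) π - Aent i j l b (X 1 1) π)) * W π = 0 := by
    simp only [sub_mul, add_mul, Finset.sum_sub_distrib, Finset.sum_add_distrib, hA, hA', sub_self, add_zero]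
  have hfin : (if b = 0 then (4 : ℝ) else -4) * W π' = 0 := by
    have h := hsum
    rw [Finset.sum_congr rfl (fun π _ => by rw [hcoef π])] at h
    rw [Finset.sum_eq_single π'] at h
    · simpa using h
    · intro π _ hπ
      rw [if_neg hπ, zero_mul]
    · intro h'
      exact absurd (Finset.mem_univ _) h'
  rcases mul_eq_zero.1 hfin with h4 | h0
  · exfalso
    by_cases hb : b = 0
    · rw [if_pos hb] at h4; norm_num at h4
    · rw [if_neg hb] at h4; norm_num at h4
  · exact h0

/-! ## §3 Uniqueness of the junta NMF -/

/-- Swapping blocks `i ↔ l` and pointer coordinates `1 ↔ 3`. -/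
theorem Aent_swap13 (i j l : Fin m) (b : ZMod 2) (x : Fin m → Fin t → ZMod 2)
    (π : Fin t × Fin t × Fin t) : Aent l j i b x π = Aent i j l b x (π.2.2, π.2.1, π.1) := by
  unfold Aent
  rw [show x l π.1 + x j π.2.1 + x i π.2.2 = x i π.2.2 + x j π.2.1 + x l π.1 by ring]

/-- Swapping blocks `i ↔ j` and pointer coordinates `1 ↔ 2`. -/
theorem Aent_swap12 (i j l : Fin m) (b : ZMod 2) (x : Fin m → Fin t → ZMod 2)
    (π : Fin t × Fin t × Fin t) : Aent j i l b x π = Aent i j l b x (π.2.1, π.1, π.2.2) := by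
  unfold Aent
  rw [show x j π.1 + x i π.2.1 + x l π.2.2 = x i π.2.1 + x j π.1 + x l π.2.2 by ring]

/-- The coordinate swap `1 ↔ 3` as an involutive equivalence of pointer triples. -/
def swap13 : (Fin t × Fin t × Fin t) ≃ (Fin t × Fin t × Fin t) :=
  ⟨fun π => (π.2.2, π.2.1, π.1), fun π => (π.2.2, π.2.1, π.1), fun _ => rfl, fun _ => rfl⟩

/-- The coordinate swap `1 ↔ 2` as an involutive equivalence of pointer triples. -/
def swap12 : (Fin t × Fin t × Fin t) ≃ (Fin t × Fin t × Fin t) :=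
  ⟨fun π => (π.2.1, π.1, π.2.2), fun π => (π.2.1, π.1, π.2.2), fun _ => rfl, fun _ => rfl⟩

/-- **Support of a dual column.** If `Σ_π A[x,π]·W(π) = 0` for every table `x` satisfied at `π₀`, then `W` is
supported on `{π₀}` (slice vanishing in each of the three blocks). -/
theorem W_eq_zero_of_ne {i j l : Fin m} (hij : i ≠ j) (hil : i ≠ l) (hjl : j ≠ l) (b : ZMod 2)
    (W : Fin t × Fin t × Fin t → ℝ) (π₀ : Fin t × Fin t × Fin t)
    (hW : ∀ x : Fin m → Fin t → ZMod 2, x i π₀.1 + x j π₀.2.1 + x l π₀.2.2 = b →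
      ∑ π, Aent i j l b x π * W π = 0)
    (π' : Fin t × Fin t × Fin t) (hne : π' ≠ π₀) : W π' = 0 := by
  by_cases h1 : π'.1 = π₀.1
  · by_cases h2 : π'.2.1 = π₀.2.1
    · have h3 : π'.2.2 ≠ π₀.2.2 := fun h3 => hne (Prod.ext h1 (Prod.ext h2 h3))
      -- blocks `(l, j, i)` through `swap13`
      have key := sliceW_eq_zero (t := t) hjl.symm hil.symm hij.symm b (fun π => W (swap13 π)) (swap13 π₀)
        (fun x hx => ?_) (swap13 π') h3
      · exact key
      · have hx' : x i π₀.1 + x j π₀.2.1 + x l π₀.2.2 = b := by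
          rw [← hx]; show _ = x l π₀.2.2 + x j π₀.2.1 + x i π₀.1; ring
        rw [show (∑ π, Aent l j i b x π * W (swap13 π)) = ∑ π, Aent i j l b x π * W π from
          (Finset.sum_congr rfl fun π _ => by rw [Aent_swap13]; rfl).trans
            (Equiv.sum_comp swap13 (fun π => Aent i j l b x π * W π))]
        exact hW x hx'
    · -- blocks `(j, i, l)` through `swap12`
      have key := sliceW_eq_zero (t := t) hij.symm hjl hil b (fun π => W (swap12 π)) (swap12 π₀)
        (fun x hx => ?_) (swap12 π') h2
      · exact key
      · have hx' : x i π₀.1 + x j π₀.2.1 + x l π₀.2.2 = b := by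
          rw [← hx]; show _ = x j π₀.2.1 + x i π₀.1 + x l π₀.2.2; ring
        rw [show (∑ π, Aent j i l b x π * W (swap12 π)) = ∑ π, Aent i j l b x π * W π from
          (Finset.sum_congr rfl fun π _ => by rw [Aent_swap12]; rfl).trans
            (Equiv.sum_comp swap12 (fun π => Aent i j l b x π * W π))]
        exact hW x hx'
  · exact sliceW_eq_zero hij hil hjl b W π₀ hW π' h1

/-- **The junta NMF of the single-equation lift is unique.** Let `i, j, l` be distinct blocks, `b ∈ 𝔽₂`, and let
`U ≥ 0` (tables × pointers) and `V ≥ 0` (pointers × pointers) factorise the 0/1 matrix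
`A[x,π] = 1[x_i(π₁)+x_j(π₂)+x_l(π₃) ≠ b]`: `A[x,π] = Σ_k U[x,k]·V[k,π]`. Then `V` is monomial — there is a bijection
`σ` of the pointer triples with `V[k,π] ≠ 0 ↔ π = σ k` — and every column of `U` is a non-negative multiple of a
column of `A`: `U[x,k] = A[x,σ k]·V⁻¹[σ k, k]`. (So every `t³`-term non-negative factorisation is the junta one up
to permutation and scaling.) -/
theorem junta_nmf_unique {i j l : Fin m} (hij : i ≠ j) (hil : i ≠ l) (hjl : j ≠ l) (b : ZMod 2)
    (U : (Fin m → Fin t → ZMod 2) → (Fin t × Fin t × Fin t) → ℝ)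
    (V : Matrix (Fin t × Fin t × Fin t) (Fin t × Fin t × Fin t) ℝ)
    (hU : ∀ x k, 0 ≤ U x k) (hV : ∀ k π, 0 ≤ V k π)
    (hfact : ∀ x π, Aent i j l b x π = ∑ k, U x k * V k π) :
    ∃ σ : (Fin t × Fin t × Fin t) ≃ (Fin t × Fin t × Fin t),
      (∀ k π, V k π ≠ 0 ↔ π = σ k) ∧ (∀ x k, U x k = Aent i j l b x (σ k) * V⁻¹ (σ k) k) := by
  -- `V` is invertible: a kernel vector of `V` would be a linear relation among the columns of `A`
  have hinj : Function.Injective V.mulVec := by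
    intro z z' hzz'
    have hz : V.mulVec (z - z') = 0 := by rw [Matrix.mulVec_sub, hzz', sub_self]
    have hli := linearIndependent_Aent (t := t) hij hil hjl b
    rw [Fintype.linearIndependent_iff] at hli
    have hcomb : ∑ π, (z - z') π • (fun (x : Fin m → Fin t → ZMod 2) => Aent i j l b x π) = 0 := by
      funext x
      simp only [Finset.sum_apply, Pi.smul_apply, smul_eq_mul, Pi.zero_apply]
      calc ∑ π, (z - z') π * Aent i j l b x π
          = ∑ π, (z - z') π * ∑ k, U x k * V k π := by
            refine Finset.sum_congr rfl fun π _ => ?_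
            rw [hfact x π]
        _ = ∑ k, U x k * (V.mulVec (z - z')) k := by
            simp only [Matrix.mulVec, dotProduct, Finset.mul_sum]
            rw [Finset.sum_comm]
            refine Finset.sum_congr rfl fun k _ => Finset.sum_congr rfl fun π _ => ?_
            ring
        _ = 0 := by simp [hz]
    have := hli (z - z') hcomb
    exact sub_eq_zero.1 (funext this)
  have hunit : IsUnit V := Matrix.mulVec_injective_iff_isUnit.1 hinj
  have hdet : IsUnit V.det := (Matrix.isUnit_iff_isUnit_det V).1 hunit
  have hVW : V * V⁻¹ = 1 := Matrix.mul_nonsing_inv V hdet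
  set W := V⁻¹ with hWdef
  -- `U = A · W`
  have hUAW : ∀ x k, U x k = ∑ π, Aent i j l b x π * W π k := by
    intro x k
    have h1 : U x k = ∑ k', U x k' * (V * W) k' k := by
      rw [hVW]
      simp [Matrix.one_apply]
    rw [h1]
    simp only [Matrix.mul_apply, Finset.mul_sum]
    rw [Finset.sum_comm]
    refine Finset.sum_congr rfl fun π _ => ?_
    rw [hfact x π, Finset.sum_mul]
    refine Finset.sum_congr rfl fun k' _ => ?_
    ring
  -- positivity: `V k π₀ > 0` forces `U[x,k] = 0` on the zero set of column `π₀`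
  have hzero : ∀ k π₀, 0 < V k π₀ → ∀ x, Aent i j l b x π₀ = 0 → U x k = 0 := by
    intro k π₀ hpos x hx
    have hs : ∑ k', U x k' * V k' π₀ = 0 := by rw [← hfact x π₀, hx]
    have hall := (Finset.sum_eq_zero_iff_of_nonneg (fun k' _ => mul_nonneg (hU x k') (hV k' π₀))).1 hs
    have hk := hall k (Finset.mem_univ k)
    rcases mul_eq_zero.1 hk with h | h
    · exact h
    · exact absurd h hpos.ne'
  -- hence the `k`-th column of `W` is supported on `{π₀}`
  have hsupp : ∀ k π₀, 0 < V k π₀ → ∀ π', π' ≠ π₀ → W π' k = 0 := by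
    intro k π₀ hpos π' hne
    refine W_eq_zero_of_ne hij hil hjl b (fun π => W π k) π₀ (fun x hx => ?_) π' hne
    rw [← hUAW x k]
    refine hzero k π₀ hpos x ?_
    unfold Aent
    rw [if_pos hx]
  -- each row `k` of `V` has a positive entry
  have hrow : ∀ k, ∃ π₀, 0 < V k π₀ := by
    intro k
    by_contra hnone
    push Not at hnone
    have hVk : ∀ π, V k π = 0 := fun π => le_antisymm (hnone π) (hV k π)
    have h := congrFun (congrFun hVW k) k
    rw [Matrix.mul_apply, Matrix.one_apply, if_pos rfl] at h
    simp [hVk] at h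
  -- and only one: two would kill the whole column `k` of `W`
  have huniq : ∀ k π₀ π₁, 0 < V k π₀ → 0 < V k π₁ → π₀ = π₁ := by
    intro k π₀ π₁ h0 h1
    by_contra hne
    have hcol : ∀ π, W π k = 0 := by
      intro π
      by_cases hπ : π = π₀
      · exact hsupp k π₁ h1 π (hπ ▸ hne)
      · exact hsupp k π₀ h0 π hπ
    have h := congrFun (congrFun hVW k) k
    rw [Matrix.mul_apply, Matrix.one_apply, if_pos rfl] at h
    simp [hcol] at h
  choose σf hσf using hrow
  have hVzero : ∀ k π, π ≠ σf k → V k π = 0 := by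
    intro k π hπ
    by_contra hV0
    exact hπ (huniq k π (σf k) (lt_of_le_of_ne (hV k π) (Ne.symm hV0)) (hσf k))
  -- `σ` is injective, hence a bijection
  have hσinj : Function.Injective σf := by
    intro k k' hkk'
    by_contra hne
    have h1 : (V * W) k k' = 0 := by rw [hVW, Matrix.one_apply, if_neg hne]
    have h2 : (V * W) k k' = V k (σf k) * W (σf k) k' := by
      rw [Matrix.mul_apply]
      apply Finset.sum_eq_single (σf k)
      · intro π _ hπ
        rw [hVzero k π hπ, zero_mul]
      · intro h
        exact absurd (Finset.mem_univ _) h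
    have h3 : W (σf k) k' = 0 := by
      rw [h2] at h1
      rcases mul_eq_zero.1 h1 with h | h
      · exact absurd h (hσf k).ne'
      · exact h
    have hcol : ∀ π, W π k' = 0 := by
      intro π
      by_cases hπ : π = σf k'
      · rw [hπ, ← hkk']
        exact h3
      · exact hsupp k' (σf k') (hσf k') π hπ
    have h := congrFun (congrFun hVW k') k'
    rw [Matrix.mul_apply, Matrix.one_apply, if_pos rfl] at h
    simp [hcol] at h
  have hσbij : Function.Bijective σf := Finite.injective_iff_bijective.1 hσinj
  refine ⟨Equiv.ofBijective σf hσbij, fun k π => ?_, fun x k => ?_⟩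
  · rw [Equiv.ofBijective_apply]
    constructor
    · intro hne0
      exact huniq k π (σf k) (lt_of_le_of_ne (hV k π) (Ne.symm hne0)) (hσf k)
    · rintro rfl
      exact (hσf k).ne'
  · rw [Equiv.ofBijective_apply, hUAW x k]
    apply Finset.sum_eq_single (σf k)
    · intro π _ hπ
      rw [hsupp k (σf k) (hσf k) π hπ, mul_zero]
    · intro h
      exact absurd (Finset.mem_univ _) h


/-- **Registered def-free form (sub-goal `junta_nmf_unique_explicit` of stmt-PneNP-10680)** of
`junta_nmf_unique`. -/
theorem junta_nmf_unique_explicit : ∀ {m t : ℕ} {i j l : Fin m}, i ≠ j → i ≠ l → j ≠ l → ∀ (b : ZMod 2)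
    (U : (Fin m → Fin t → ZMod 2) → (Fin t × Fin t × Fin t) → ℝ)
    (V : Matrix (Fin t × Fin t × Fin t) (Fin t × Fin t × Fin t) ℝ),
    (∀ x k, 0 ≤ U x k) → (∀ k π, 0 ≤ V k π) →
    (∀ x π, (if x i π.1 + x j π.2.1 + x l π.2.2 = b then (0 : ℝ) else 1) = ∑ k, U x k * V k π) →
    ∃ σ : (Fin t × Fin t × Fin t) ≃ (Fin t × Fin t × Fin t), (∀ k π, V k π ≠ 0 ↔ π = σ k) ∧
      ∀ x k, U x k =
        (if x i (σ k).1 + x j (σ k).2.1 + x l (σ k).2.2 = b then (0 : ℝ) else 1) * V⁻¹ (σ k) k :=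
  fun hij hil hjl b U V hU hV hfact => junta_nmf_unique hij hil hjl b U V hU hV hfact

end

end Summit.PneNP.PneNP.Theorems.XorDoor.RankCorner
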